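import Summits.QuantumFields.YangMills.Theorems.VirialFluxGapAnchorChartSmooth
import Literature.Analysis.Asymptotics.LaplaceMethodChartComposition
import HarnessLib

/-!
# The two-anchor window map: INJECTIVITY and THE CHART IDENTITY `hloc` OF THE ANCHOR CORE on `SU2 × SU2`
# (layer (B2) of the DIRECT Laplace road to ⟨stmt-QuantumFields-24204⟩ `VirialFluxGap.SharpTwistedLaplace`)

Helper module (free-hands work of width seat ym-line-sfw-p2-w3 g57, cell ym-idea-1; `--supports 24204`).  Sequel of
✓`VirialFluxGapAnchorChartSmooth`; uses ✓`VirialFluxGapAnchorSliceAlgebra` (the two-anchor slice property) and Literature's chart plumbing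
✓`Literature.Analysis.Asymptotics.chart_comp_of_injOn_ofReal`.  For `Θ' = anchorMap ω_C ω_N ω_× C₀ N₀ : ℝ³ × ℝ³ → SU2 × SU2`
(✓`VirialFluxGapAnchorChartDefs`) on the window `W = closedBall 0 r × closedBall 0 R`:
* §1 ★★ `injOn_anchorMap` (`r, R < π/2`) — `Θ'` is INJECTIVE on `W`: equal images give a relative rotation `k'⁻¹k` conjugating one slice
  point to another, hence `k'⁻¹k = ±1` (✓`su2_eq_one_or_negOne_of_conj_anchor_pair`), `−1` being excluded by `Re e^{ιz} = cos‖z‖ > 0`, and then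
  the exponential chart is injective on `‖·‖ < π`;
* §2 `haar_prod_restrict_image_expPoint` — the PRODUCT exponential chart of `SU2 × SU2`:
  `(Haar ⊗ Haar)|_{(exp × exp)(B_π²)} = (exp × exp)_*((w_exp ⊗ w_exp)·Leb⁶|_{B_π²})` (✓`T4HaarSU2ExpChart.map_expPoint_expMeasure` twice,
  Mathlib `prod_withDensity`, `Measure.map_prod_map`); `volume_restrict_image_anchorCoord` (`r < π/2`, `R < 1`) — Mathlib's change of variables
  `map_withDensity_abs_det_fderiv_eq_addHaar` for `anchorCoord` on `W` (`C¹` by ✓`contDiffAt_anchorCoord`, injective by §1);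
  `anchorCoord_mem_ball` — the window is read inside `B_π²`;
* §3 ★★★ `haar_prod_restrict_image_anchorMap` — THE CHART IDENTITY OF THE ANCHOR CORE:
  `(Haar ⊗ Haar)|_{Θ'(W)} = Θ'_*(anchorDensity · Leb⁶|_W)` for `r < π/2`, `R < 1` — literally the `hloc` hypothesis of
  ✓`Literature.MeasureTheory.Group.OrbitTubeMeasure.restrict_tube_eq_map_withDensity_ofReal` for the diagonal conjugation action of `SU(2)`
  on the anchor pair (`Z = ℝ³`, `e = expPoint`, `κ = ρ =` Lebesgue), to be tensored with the conjugated exponential charts of the remaining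
  components of `X_fix` (their density `w_exp` is `z`-independent) to give `hloc` on `X_fix`.
Everything here is PROVED; no definitions, no named facts (namespace `Summit.QuantumFields.YangMills.Theorems.VirialFluxGap.AnchorSlice`).
HONEST FRAMING: measure-theoretic plumbing in fixed dimension `6`; ⟨24204⟩, ⟨24319⟩ and every rung stay OPEN; the Yang–Mills mass gap (Clay) is
NOT touched; no summit is proved by a line.

## References
* G. E. Bredon, *Introduction to Compact Transformation Groups* (1972), Ch. II §§4–5 (slices, tubes). [Bredon1972]
* K. W. Breitung, *Asymptotic Approximations for Probability Integrals*, LNM 1592 (1994), §2.3 Definitions 4–5; Thm 41 p. 56. [Breitung1994]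
-/

set_option autoImplicit false

noncomputable section

open scoped Quaternion RealInnerProductSpace
open NormedSpace MeasureTheory Set Filter Topology
open Literature.MathematicalPhysics.QuantumLattice
open Literature.MathematicalPhysics.QuantumFieldTheory.Balaban1983to89
open Literature.MathematicalPhysics.QuantumFieldTheory.Balaban1983to89.T4HaarSU2ExpChart
open Literature.MathematicalPhysics.QuantumFieldTheory.Balaban1983to89.T4ExpWindowSmallField
open Literature.MathematicalPhysics.QuantumFieldTheory.Balaban1983to89.B15Prop1ChartCalculusSU2
open Literature.MathematicalPhysics.QuantumFieldTheory.Balaban1983to89.T4WilsonGaugeFlatDirection (su2Quat_injective)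
open Literature.MathematicalPhysics.QuantumFieldTheory.Balaban1983to89.T4WilsonLinkAffine (su2Quat_inv)
open Literature.MathematicalPhysics.QuantumFieldTheory.Balaban1983to89.T4HaarSU2Translate (su2Quat_mul su2Quat_one continuous_su2Quat)
open Summit.QuantumFields.YangMills.Theorems.FemtoTransferGap
open Literature.MathematicalPhysics.QuantumFieldTheory (haarProbability)

namespace Summit.QuantumFields.YangMills.Theorems.VirialFluxGap.AnchorSlice

section Anchors

variable {ωC ωN ωX : EuclideanSpace ℝ (Fin 3)} {C₀ N₀ : SU2}

/-! ## §1 Injectivity of the window map (the two-anchor slice property) -/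

/-- Components of a vector of `ℝ³` are bounded by its norm; squares of two of them by the squared norm. [folklore] -/
theorem sq_add_sq_le_norm_sq (a : EuclideanSpace ℝ (Fin 3)) : (a 1) ^ 2 + (a 2) ^ 2 ≤ ‖a‖ ^ 2 := by
  rw [EuclideanSpace.real_norm_sq_eq, Fin.sum_univ_three]
  nlinarith [sq_nonneg (a 0)]

/-- `expPoint z ≠ expPoint z' · negOne` when `‖z‖, ‖z'‖ < π/2` (real parts `cos‖z‖ > 0 > −cos‖z'‖`). [folklore] -/
theorem expPoint_ne_mul_negOne {z z' : EuclideanSpace ℝ (Fin 3)} (hz : ‖z‖ < Real.pi / 2) (hz' : ‖z'‖ < Real.pi / 2) :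
    expPoint z ≠ expPoint z' * negOne := by
  intro h
  have h' := congrArg (fun U => (su2Quat U).re) h
  simp only [su2Quat_mul, su2Quat_expPoint, su2Quat_negOne, mul_neg, mul_one, Quaternion.re_neg, exp_imQuat_re] at h'
  have h1 : 0 < Real.cos ‖z‖ := Real.cos_pos_of_mem_Ioo ⟨by linarith [norm_nonneg z, Real.pi_pos], hz⟩
  have h2 : 0 < Real.cos ‖z'‖ := Real.cos_pos_of_mem_Ioo ⟨by linarith [norm_nonneg z', Real.pi_pos], hz'⟩
  linarith

/-- ★★ **The window map is injective** on `closedBall 0 r × closedBall 0 R` for `r, R < π/2`: the two-anchor slice property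
(✓`su2_eq_one_or_negOne_of_conj_anchor_pair`) plus the injectivity of the exponential chart on `‖·‖ < π`.
[cite: Bredon1972, Ch. II §§4–5] -/
theorem injOn_anchorMap (hC : ‖ωC‖ = 1) (hN : ‖ωN‖ = 1) (hCN : ⟪ωC, ωN⟫ = 0)
    (hX : imQuat ωX = imQuat ωC * imQuat ωN) (hC₀ : su2Quat C₀ = imQuat ωC)
    (hN₀ : su2Quat N₀ = imQuat ωN ∨ su2Quat N₀ = -imQuat ωN) {r R : ℝ} (hr : r < Real.pi / 2) (hR : R < Real.pi / 2) :
    InjOn (anchorMap ωC ωN ωX C₀ N₀)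
      (Metric.closedBall (0 : EuclideanSpace ℝ (Fin 3)) r ×ˢ Metric.closedBall (0 : EuclideanSpace ℝ (Fin 3)) R) := by
  have hX1 : ‖ωX‖ = 1 := by
    rw [← norm_imQuat, hX, norm_mul, norm_imQuat, norm_imQuat, hC, hN, mul_one]
  have hNX : ⟪ωN, ωX⟫ = 0 := by
    have h := inner_pure_mul_right (imQuat_re ωC) (imQuat_re ωN)
    rw [← hX, real_inner_comm, Quaternion.inner_def] at h
    simp [imQuat_apply] at h
    rw [real_inner_comm, PiLp.inner_apply]; simp
    rw [Fin.sum_univ_three]; linarith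
  rintro ⟨z, a⟩ ⟨hz, ha⟩ ⟨z', a'⟩ ⟨hz', ha'⟩ heq
  simp only [Metric.mem_closedBall, dist_zero_right] at hz ha hz' ha'
  have hzπ : ‖z‖ < Real.pi / 2 := lt_of_le_of_lt hz hr
  have hz'π : ‖z'‖ < Real.pi / 2 := lt_of_le_of_lt hz' hr
  have haR : ‖a‖ < Real.pi / 2 := lt_of_le_of_lt ha hR
  have ha'R : ‖a'‖ < Real.pi / 2 := lt_of_le_of_lt ha' hR
  obtain ⟨h1, h2⟩ := Prod.ext_iff.mp heq
  simp only [anchorMap] at h1 h2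
  set k := expPoint z with hk
  set k' := expPoint z' with hk'
  -- the relative rotation `k'⁻¹ k` conjugates one slice point to another
  have h1' : (k'⁻¹ * k) * (seamSlice ωC C₀ (a 0)) * (k'⁻¹ * k)⁻¹ = seamSlice ωC C₀ (a' 0) := by
    rw [mul_inv_rev, inv_inv, show k'⁻¹ * k * seamSlice ωC C₀ (a 0) * (k⁻¹ * k') = k'⁻¹ * (k * seamSlice ωC C₀ (a 0) * k⁻¹) * k' by
      group, h1]; group
  have h2' : (k'⁻¹ * k) * (linkSlice ωN ωX N₀ (a 1) (a 2)) * (k'⁻¹ * k)⁻¹ = linkSlice ωN ωX N₀ (a' 1) (a' 2) := by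
    rw [mul_inv_rev, inv_inv, show k'⁻¹ * k * linkSlice ωN ωX N₀ (a 1) (a 2) * (k⁻¹ * k') =
      k'⁻¹ * (k * linkSlice ωN ωX N₀ (a 1) (a 2) * k⁻¹) * k' by group, h2]; group
  have ht : |a 0| < Real.pi / 2 := lt_of_le_of_lt (by simpa using PiLp.norm_apply_le a 0) haR
  have ht' : |a' 0| < Real.pi / 2 := lt_of_le_of_lt (by simpa using PiLp.norm_apply_le a' 0) ha'R
  have hb : (a 1) ^ 2 + (a 2) ^ 2 < (Real.pi / 2) ^ 2 :=
    lt_of_le_of_lt (sq_add_sq_le_norm_sq a) (by nlinarith [norm_nonneg a, Real.pi_pos])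
  have hb' : (a' 1) ^ 2 + (a' 2) ^ 2 < (Real.pi / 2) ^ 2 :=
    lt_of_le_of_lt (sq_add_sq_le_norm_sq a') (by nlinarith [norm_nonneg a', Real.pi_pos])
  have hkk := su2_eq_one_or_negOne_of_conj_anchor_pair hC hN hCN hX hC₀ hN₀ (k'⁻¹ * k) ht ht' hb hb' h1' h2'
  -- `k = k'`
  have hkeq : k = k' := by
    rcases hkk with h | h
    · calc k = k' * (k'⁻¹ * k) := by group
        _ = k' := by rw [h, mul_one]
    · exfalso
      have : k = k' * negOne := by
        calc k = k' * (k'⁻¹ * k) := by group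
          _ = k' * negOne := by rw [h]
      exact expPoint_ne_mul_negOne hzπ hz'π this
  have hzz : z = z' := injOn_expPoint (mem_ball_zero_iff.2 (by linarith [Real.pi_pos]))
    (mem_ball_zero_iff.2 (by linarith [Real.pi_pos])) hkeq
  -- the slice coordinates agree
  rw [hkeq] at h1 h2
  have hs1 : seamSlice ωC C₀ (a 0) = seamSlice ωC C₀ (a' 0) := by
    have := congrArg (fun U => k'⁻¹ * U * k') h1
    simpa [mul_assoc] using this
  have hs2 : linkSlice ωN ωX N₀ (a 1) (a 2) = linkSlice ωN ωX N₀ (a' 1) (a' 2) := by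
    have := congrArg (fun U => k'⁻¹ * U * k') h2
    simpa [mul_assoc] using this
  simp only [seamSlice, linkSlice, mul_left_inj] at hs1 hs2
  have ha0 : a 0 = a' 0 := by
    have h := injOn_expPoint (mem_ball_zero_iff.2 (by rw [norm_smul, hC, mul_one, Real.norm_eq_abs]; linarith [Real.pi_pos]))
      (mem_ball_zero_iff.2 (by rw [norm_smul, hC, mul_one, Real.norm_eq_abs]; linarith [Real.pi_pos])) hs1
    have hω : ωC ≠ 0 := by intro h0; rw [h0, norm_zero] at hC; exact zero_ne_one hC
    exact smul_left_injective ℝ hω h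
  have hnorm : ∀ c₁ c₂ : ℝ, ‖c₁ • ωN + c₂ • ωX‖ ^ 2 = c₁ ^ 2 + c₂ ^ 2 := by
    intro c₁ c₂
    rw [@norm_add_sq_real, norm_smul, norm_smul, hN, hX1, mul_one, mul_one, inner_smul_left, inner_smul_right, hNX,
      Real.norm_eq_abs, Real.norm_eq_abs, sq_abs, sq_abs]
    simp
  have hb12 : (a 1) • ωN + (a 2) • ωX = (a' 1) • ωN + (a' 2) • ωX := by
    refine injOn_expPoint (mem_ball_zero_iff.2 ?_) (mem_ball_zero_iff.2 ?_) hs2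
    · have := hnorm (a 1) (a 2); nlinarith [norm_nonneg ((a 1) • ωN + (a 2) • ωX), Real.pi_pos]
    · have := hnorm (a' 1) (a' 2); nlinarith [norm_nonneg ((a' 1) • ωN + (a' 2) • ωX), Real.pi_pos]
  have hNN1 : ⟪ωN, ωN⟫ = 1 := by rw [real_inner_self_eq_norm_sq, hN]; norm_num
  have hXX1 : ⟪ωX, ωX⟫ = 1 := by rw [real_inner_self_eq_norm_sq, hX1]; norm_num
  have hXN : ⟪ωX, ωN⟫ = 0 := by rw [real_inner_comm]; exact hNX
  have ha1 : a 1 = a' 1 := by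
    have := congrArg (fun v => ⟪v, ωN⟫) hb12
    simp only [inner_add_left, inner_smul_left, hNN1, hXN, RCLike.conj_to_real, mul_one, mul_zero, add_zero] at this
    exact this
  have ha2 : a 2 = a' 2 := by
    have := congrArg (fun v => ⟪v, ωX⟫) hb12
    simp only [inner_add_left, inner_smul_left, hNX, hXX1, RCLike.conj_to_real, mul_one, mul_zero, zero_add] at this
    exact this
  have haa : a = a' := by
    ext i
    fin_cases i
    · exact ha0
    · exact ha1
    · exact ha2
  rw [hzz, haa]

/-! ## §2 The product exponential chart and the change of variables -/

/-- The window map is continuous. [folklore] -/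
theorem continuous_anchorMap : Continuous (anchorMap ωC ωN ωX C₀ N₀) := by
  have hk : Continuous fun w : EuclideanSpace ℝ (Fin 3) × EuclideanSpace ℝ (Fin 3) => expPoint w.1 :=
    continuous_expPoint.comp continuous_fst
  have hc : ∀ i : Fin 3, Continuous fun w : EuclideanSpace ℝ (Fin 3) × EuclideanSpace ℝ (Fin 3) => w.2 i := fun i =>
    (EuclideanSpace.proj i : EuclideanSpace ℝ (Fin 3) →L[ℝ] ℝ).continuous.comp continuous_snd
  have h0 : Continuous fun w : EuclideanSpace ℝ (Fin 3) × EuclideanSpace ℝ (Fin 3) => seamSlice ωC C₀ (w.2 0) :=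
    (continuous_expPoint.comp ((hc 0).smul continuous_const)).mul continuous_const
  have h1 : Continuous fun w : EuclideanSpace ℝ (Fin 3) × EuclideanSpace ℝ (Fin 3) => linkSlice ωN ωX N₀ (w.2 1) (w.2 2) :=
    (continuous_expPoint.comp (((hc 1).smul continuous_const).add ((hc 2).smul continuous_const))).mul continuous_const
  exact ((hk.mul h0).mul hk.inv).prodMk ((hk.mul h1).mul hk.inv)

/-- `anchorCoord` is measurable (Borel structure on `ℍ` chosen locally; `logVec` is a measurable piecewise formula). [folklore] -/
theorem measurable_anchorCoord : Measurable (anchorCoord ωC ωN ωX C₀ N₀) := by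
  borelize ℍ
  have hre : Measurable fun q : ℍ => q.re := (contDiff_quat_re (n := ⊤)).continuous.measurable
  have him : Measurable (imVec : ℍ → EuclideanSpace ℝ (Fin 3)) := imVecL.continuous.measurable
  have hlog : Measurable logVec := by
    have h1 : Measurable fun q : ℍ => Real.arccos q.re • (EuclideanSpace.single (0 : Fin 3) (1 : ℝ)) :=
      (Real.continuous_arccos.measurable.comp hre).smul_const _
    have h2 : Measurable fun q : ℍ => (Real.arccos q.re / ‖imVec q‖) • imVec q :=
      ((Real.continuous_arccos.measurable.comp hre).div him.norm).smul him
    refine Measurable.ite ?_ h1 h2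
    exact measurableSet_eq_fun him measurable_const
  have hq : Measurable (su2Quat : SU2 → ℍ) := continuous_su2Quat.measurable
  exact (hlog.comp (hq.comp continuous_anchorMap.measurable.fst)).prodMk
    (hlog.comp (hq.comp continuous_anchorMap.measurable.snd))

/-- The window map factors through the exponential chart: `(expPoint × expPoint) ∘ anchorCoord = anchorMap`. [folklore] -/
theorem prodMap_expPoint_comp_anchorCoord :
    (fun v : EuclideanSpace ℝ (Fin 3) × EuclideanSpace ℝ (Fin 3) => (expPoint v.1, expPoint v.2)) ∘ anchorCoord ωC ωN ωX C₀ N₀ =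
      anchorMap ωC ωN ωX C₀ N₀ := by
  funext w
  simp only [Function.comp_apply, anchorCoord, expPoint_logVec]

/-- ★ **THE PRODUCT EXPONENTIAL CHART OF `SU2 × SU2`**: `(Haar ⊗ Haar)|_{(exp×exp)(B_π × B_π)} = (exp×exp)_*((w_exp ⊗ w_exp) · Leb|_{B_π×B_π})`
(✓`T4HaarSU2ExpChart.map_expPoint_expMeasure`, twice). [folklore] -/
theorem haar_prod_restrict_image_expPoint :
    ((haarProbability SU2).prod (haarProbability SU2)).restrict
        ((fun v : EuclideanSpace ℝ (Fin 3) × EuclideanSpace ℝ (Fin 3) => (expPoint v.1, expPoint v.2)) ''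
          (Metric.ball (0 : EuclideanSpace ℝ (Fin 3)) Real.pi ×ˢ Metric.ball (0 : EuclideanSpace ℝ (Fin 3)) Real.pi)) =
      ((((volume : Measure (EuclideanSpace ℝ (Fin 3))).prod (volume : Measure (EuclideanSpace ℝ (Fin 3)))).restrict
          (Metric.ball (0 : EuclideanSpace ℝ (Fin 3)) Real.pi ×ˢ Metric.ball (0 : EuclideanSpace ℝ (Fin 3)) Real.pi)).withDensity
        fun v => ENNReal.ofReal (expWeight v.1 * expWeight v.2)).map
        (fun v : EuclideanSpace ℝ (Fin 3) × EuclideanSpace ℝ (Fin 3) => (expPoint v.1, expPoint v.2)) := by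
  have hπ : MeasurableSet (Metric.ball (0 : EuclideanSpace ℝ (Fin 3)) Real.pi) := measurableSet_ball
  -- one factor: `Haar|_{exp(B_π)} = Haar` and `= exp_* expMeasure`
  have h1 : (haarProbability SU2).restrict (expPoint '' Metric.ball (0 : EuclideanSpace ℝ (Fin 3)) Real.pi) = expMeasure.map expPoint := by
    rw [haarProbability_restrict_image hπ subset_rfl, expMeasure, restrict_withDensity hπ, Measure.restrict_restrict hπ, inter_self]
  -- the right-hand side is `(expMeasure ⊗ expMeasure)` pushed forward
  have hR : ((((volume : Measure (EuclideanSpace ℝ (Fin 3))).prod (volume : Measure (EuclideanSpace ℝ (Fin 3)))).restrict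
      (Metric.ball (0 : EuclideanSpace ℝ (Fin 3)) Real.pi ×ˢ Metric.ball (0 : EuclideanSpace ℝ (Fin 3)) Real.pi)).withDensity
        fun v => ENNReal.ofReal (expWeight v.1 * expWeight v.2)) = expMeasure.prod expMeasure := by
    rw [← Measure.prod_restrict, expMeasure, prod_withDensity measurable_expWeight.ennreal_ofReal measurable_expWeight.ennreal_ofReal]
    congr 1
    funext v
    rw [ENNReal.ofReal_mul (expWeight_nonneg _)]
  rw [hR, show (fun v : EuclideanSpace ℝ (Fin 3) × EuclideanSpace ℝ (Fin 3) => (expPoint v.1, expPoint v.2)) = Prod.map expPoint expPoint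
    from rfl, ← Measure.map_prod_map _ _ measurable_expPoint measurable_expPoint, Set.prodMap_image_prod, ← Measure.prod_restrict, h1]

/-- ★ **THE INNER CHANGE OF VARIABLES** (Mathlib `map_withDensity_abs_det_fderiv_eq_addHaar` for `anchorCoord` on the window
`closedBall 0 r × closedBall 0 R`, `r < π/2`, `R < 1`): `Leb⁶|_{anchorCoord(W)} = anchorCoord_*(|det D anchorCoord| · Leb⁶|_W)`.
[cite: Breitung1994, §2.3 Definitions 4–5] -/
theorem volume_restrict_image_anchorCoord (hC : ‖ωC‖ = 1) (hN : ‖ωN‖ = 1) (hCN : ⟪ωC, ωN⟫ = 0)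
    (hX : imQuat ωX = imQuat ωC * imQuat ωN) (hC₀ : su2Quat C₀ = imQuat ωC)
    (hN₀ : su2Quat N₀ = imQuat ωN ∨ su2Quat N₀ = -imQuat ωN) {r R : ℝ} (hr : r < Real.pi / 2) (hR : R < 1) :
    ((volume : Measure (EuclideanSpace ℝ (Fin 3))).prod (volume : Measure (EuclideanSpace ℝ (Fin 3)))).restrict
        (anchorCoord ωC ωN ωX C₀ N₀ ''
          (Metric.closedBall (0 : EuclideanSpace ℝ (Fin 3)) r ×ˢ Metric.closedBall (0 : EuclideanSpace ℝ (Fin 3)) R)) =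
      ((((volume : Measure (EuclideanSpace ℝ (Fin 3))).prod (volume : Measure (EuclideanSpace ℝ (Fin 3)))).restrict
          (Metric.closedBall (0 : EuclideanSpace ℝ (Fin 3)) r ×ˢ Metric.closedBall (0 : EuclideanSpace ℝ (Fin 3)) R)).withDensity
        fun w => ENNReal.ofReal (abs (fderiv ℝ (anchorCoord ωC ωN ωX C₀ N₀) w).det)).map (anchorCoord ωC ωN ωX C₀ N₀) := by
  set W := Metric.closedBall (0 : EuclideanSpace ℝ (Fin 3)) r ×ˢ Metric.closedBall (0 : EuclideanSpace ℝ (Fin 3)) R with hW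
  have hWm : MeasurableSet W := measurableSet_closedBall.prod measurableSet_closedBall
  have hR' : R < Real.pi / 2 := by linarith [Real.pi_gt_three]
  have hderiv : ∀ w ∈ W, HasFDerivWithinAt (anchorCoord ωC ωN ωX C₀ N₀) (fderiv ℝ (anchorCoord ωC ωN ωX C₀ N₀) w) W w := by
    rintro w ⟨-, hw⟩
    have hw' : ‖w.2‖ < 1 := lt_of_le_of_lt (by simpa using hw) hR
    exact ((contDiffAt_anchorCoord hC hN hCN hX hC₀ hN₀ (n := 1) hw').differentiableAt one_ne_zero).hasFDerivAt.hasFDerivWithinAt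
  have hinj : InjOn (anchorCoord ωC ωN ωX C₀ N₀) W := by
    intro w hw w' hw' h
    have h' := congrArg (fun v : EuclideanSpace ℝ (Fin 3) × EuclideanSpace ℝ (Fin 3) => (expPoint v.1, expPoint v.2)) h
    have e := prodMap_expPoint_comp_anchorCoord (ωC := ωC) (ωN := ωN) (ωX := ωX) (C₀ := C₀) (N₀ := N₀)
    have e1 := congrFun e w
    have e2 := congrFun e w'
    simp only [Function.comp_apply] at e1 e2 h'
    rw [e1, e2] at h'
    exact injOn_anchorMap hC hN hCN hX hC₀ hN₀ hr hR' hw hw' h'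
  exact (MeasureTheory.map_withDensity_abs_det_fderiv_eq_addHaar _ hWm.nullMeasurableSet hderiv hinj).symm

/-- The window lands in the injectivity ball of the product exponential chart: `‖(anchorCoord w)_j‖ < π` for `‖a‖ < 1`. [folklore] -/
theorem anchorCoord_mem_ball (hC : ‖ωC‖ = 1) (hN : ‖ωN‖ = 1) (hCN : ⟪ωC, ωN⟫ = 0) (hX : imQuat ωX = imQuat ωC * imQuat ωN)
    (hC₀ : su2Quat C₀ = imQuat ωC) (hN₀ : su2Quat N₀ = imQuat ωN ∨ su2Quat N₀ = -imQuat ωN)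
    {w : EuclideanSpace ℝ (Fin 3) × EuclideanSpace ℝ (Fin 3)} (hw : ‖w.2‖ < 1) :
    anchorCoord ωC ωN ωX C₀ N₀ w ∈
      Metric.ball (0 : EuclideanSpace ℝ (Fin 3)) Real.pi ×ˢ Metric.ball (0 : EuclideanSpace ℝ (Fin 3)) Real.pi := by
  refine ⟨mem_ball_zero_iff.2 ?_, mem_ball_zero_iff.2 ?_⟩
  · rw [anchorCoord, norm_logVec, Real.arccos_lt_pi, re_anchor_fst hC hC₀]
    have hsin : |Real.sin (w.2 0)| < 1 := by
      have h1 : |w.2 0| < 1 := lt_of_le_of_lt (by simpa using PiLp.norm_apply_le w.2 0) hw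
      rcases eq_or_ne (w.2 0) 0 with h | h
      · rw [h, Real.sin_zero, abs_zero]; exact one_pos
      · exact (Real.abs_sin_lt_abs h).trans h1
    linarith [(abs_lt.mp hsin).2]
  · rw [anchorCoord, norm_logVec, Real.arccos_lt_pi]
    have h := re_anchor_snd (C₀ := C₀) hC hN hCN hX hN₀ w
    have hs : |Real.sinc ‖(w.2 1) • ωN + (w.2 2) • ωX‖| ≤ 1 := Real.abs_sinc_le_one _
    have h1 : |w.2 1| < 1 := lt_of_le_of_lt (by simpa using PiLp.norm_apply_le w.2 1) hw
    have hlt : |(su2Quat (anchorMap ωC ωN ωX C₀ N₀ w).2).re| < 1 := by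
      rw [h, abs_mul]
      calc |Real.sinc ‖(w.2 1) • ωN + (w.2 2) • ωX‖| * |w.2 1| ≤ 1 * |w.2 1| :=
            mul_le_mul_of_nonneg_right hs (abs_nonneg _)
        _ < 1 := by rw [one_mul]; exact h1
    linarith [(abs_lt.mp hlt).1]

/-! ## §3 The chart identity of the anchor core -/

/-- ★★★ **THE CHART IDENTITY OF THE ANCHOR CORE** (`hloc` on `SU2 × SU2`): for `r < π/2`, `R < 1`,
`(Haar ⊗ Haar)|_{Θ'(W)} = Θ'_*(anchorDensity · (Leb³ ⊗ Leb³)|_W)`, `W = closedBall 0 r × closedBall 0 R`, `Θ' = anchorMap`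
(product exponential chart ∘ Mathlib's change of variables for `anchorCoord`; ✓`chart_comp_of_injOn_ofReal`).
[cite: Breitung1994, §2.3 Definitions 4–5; Thm 41 p. 56] [cite: Bredon1972, Ch. II §§4–5] -/
theorem haar_prod_restrict_image_anchorMap (hC : ‖ωC‖ = 1) (hN : ‖ωN‖ = 1) (hCN : ⟪ωC, ωN⟫ = 0)
    (hX : imQuat ωX = imQuat ωC * imQuat ωN) (hC₀ : su2Quat C₀ = imQuat ωC)
    (hN₀ : su2Quat N₀ = imQuat ωN ∨ su2Quat N₀ = -imQuat ωN) {r R : ℝ} (hr : r < Real.pi / 2) (hR : R < 1) :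
    ((haarProbability SU2).prod (haarProbability SU2)).restrict
        (anchorMap ωC ωN ωX C₀ N₀ ''
          (Metric.closedBall (0 : EuclideanSpace ℝ (Fin 3)) r ×ˢ Metric.closedBall (0 : EuclideanSpace ℝ (Fin 3)) R)) =
      ((((volume : Measure (EuclideanSpace ℝ (Fin 3))).prod (volume : Measure (EuclideanSpace ℝ (Fin 3)))).restrict
          (Metric.closedBall (0 : EuclideanSpace ℝ (Fin 3)) r ×ˢ Metric.closedBall (0 : EuclideanSpace ℝ (Fin 3)) R)).withDensity
        fun w => ENNReal.ofReal (anchorDensity ωC ωN ωX C₀ N₀ w)).map (anchorMap ωC ωN ωX C₀ N₀) := by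
  set W := Metric.closedBall (0 : EuclideanSpace ℝ (Fin 3)) r ×ˢ Metric.closedBall (0 : EuclideanSpace ℝ (Fin 3)) R with hW
  set Θ : EuclideanSpace ℝ (Fin 3) × EuclideanSpace ℝ (Fin 3) → SU2 × SU2 := fun v => (expPoint v.1, expPoint v.2) with hΘ
  have hΘm : Measurable Θ := (measurable_expPoint.comp measurable_fst).prodMk (measurable_expPoint.comp measurable_snd)
  have hinj : InjOn Θ (Metric.ball (0 : EuclideanSpace ℝ (Fin 3)) Real.pi ×ˢ Metric.ball (0 : EuclideanSpace ℝ (Fin 3)) Real.pi) :=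
    injOn_expPoint.prodMap injOn_expPoint
  have hJ₁ : Measurable fun v : EuclideanSpace ℝ (Fin 3) × EuclideanSpace ℝ (Fin 3) => expWeight v.1 * expWeight v.2 :=
    (measurable_expWeight.comp measurable_fst).mul (measurable_expWeight.comp measurable_snd)
  have hJ₂ : Measurable fun w : EuclideanSpace ℝ (Fin 3) × EuclideanSpace ℝ (Fin 3) =>
      |(fderiv ℝ (anchorCoord ωC ωN ωX C₀ N₀) w).det| :=
    (ContinuousLinearMap.continuous_det.measurable.comp (measurable_fderiv ℝ (anchorCoord ωC ωN ωX C₀ N₀))).abs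
  have hΨW : anchorCoord ωC ωN ωX C₀ N₀ '' W ⊆
      Metric.ball (0 : EuclideanSpace ℝ (Fin 3)) Real.pi ×ˢ Metric.ball (0 : EuclideanSpace ℝ (Fin 3)) Real.pi := by
    rintro v ⟨w, ⟨-, hw⟩, rfl⟩
    exact anchorCoord_mem_ball hC hN hCN hX hC₀ hN₀ (lt_of_le_of_lt (by simpa using hw) hR)
  have hcomp : Θ ∘ anchorCoord ωC ωN ωX C₀ N₀ = anchorMap ωC ωN ωX C₀ N₀ := prodMap_expPoint_comp_anchorCoord
  have hWc : IsCompact W := (isCompact_closedBall 0 r).prod (isCompact_closedBall 0 R)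
  have hΘΨW : MeasurableSet (Θ '' (anchorCoord ωC ωN ωX C₀ N₀ '' W)) := by
    rw [Set.image_image, show (fun x => Θ (anchorCoord ωC ωN ωX C₀ N₀ x)) = anchorMap ωC ωN ωX C₀ N₀ from hcomp]
    exact (hWc.image continuous_anchorMap).isClosed.measurableSet
  have h := Literature.Analysis.Asymptotics.chart_comp_of_injOn_ofReal (μ := (haarProbability SU2).prod (haarProbability SU2))
    (κ := (volume : Measure (EuclideanSpace ℝ (Fin 3))).prod (volume : Measure (EuclideanSpace ℝ (Fin 3))))
    (ν := (volume : Measure (EuclideanSpace ℝ (Fin 3))).prod (volume : Measure (EuclideanSpace ℝ (Fin 3))))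
    hΘm measurable_anchorCoord hinj hJ₁ hJ₂ (fun w => abs_nonneg _) hΨW hΘΨW haar_prod_restrict_image_expPoint
    (volume_restrict_image_anchorCoord hC hN hCN hX hC₀ hN₀ hr hR)
  rw [hcomp] at h
  rw [h]
  rfl

end Anchors

end Summit.QuantumFields.YangMills.Theorems.VirialFluxGap.AnchorSlice

end
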